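import Summits.BirchSwinnertonDyer.BirchSwinnertonDyer.Theorems.EisensteinPrimesLocallyTrivialAwayIndex
import Summits.BirchSwinnertonDyer.BirchSwinnertonDyer.Theorems.PrintCf2SplitBadTwoLineNoSplitPrimes
import Summits.BirchSwinnertonDyer.BirchSwinnertonDyer.Theorems.PrintCf2SplitBadTwoRestrictedSelmerCMSideConditions
import Literature.NumberTheory.EllipticCurves.TwoVariableAnticyclotomicControl
import HarnessLib

/-!
# Road α, crux `PrintCf2.SplitBadTwoRankOneOfFacts` (stmt-BirchSwinnertonDyer-20368), brick (RES)(b2-i): UNRAMIFIED ⟹ LOCALLY TRIVIAL over a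
# `ℤ_p`-LINE at a finite place `w` unramified and not totally split in the line (`Gal(K̄_w/K_{∞,η}) ⧸ I_{K_w}` is pro-prime-to-`p`)

Cell `bsd-print-cf2`, width seat `bsd-line-cf2-p1-w6` g4; `--supports stmt-BirchSwinnertonDyer-20368 --as helper`. HONEST FRAMING: nothing here
closes the crux or a registered stub; no summit statement is proved by this seat; BSD is not proved by any of this. No definition, no named
fact, no `sorry`. The ONE-variable twin of the bsd-eis cell's `GreenbergFullAtSelmer.coprime_index_of_isOpen_preimagePairKer` /
`resH1Hom_decompIn_eq_zero_of_mem_unramifiedKer` (there: the `ℤ_p²`-tower, `[K : ℚ] ≤ 2`, jointly surjective pair; here: ANY number field, ONE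
`ℤ_p`-extension `κ`, at a finite place `w` with `I_w ≤ ker κ` and `D_w ≰ ker κ`), with the same engine (`coprime_index_of_surjective_onto_ker` fed the
single descended character twice, and the pro-`p′` cocycle-vanishing lemma `exists_eq_smul_sub_of_coprime_index`, p547081).

* §1 (★) `coprime_index_of_isOpen_preimageKerSubgroup` — with `F = K_w`, `H_F = res⁻¹(ker κ) ≤ Γ_F ⊇ I_F`: every open subgroup of `H_F` containing
  `I_F` has index PRIME TO `p` (`Γ_F ⧸ I_F ≅ ∏_ℓ ℤ_ℓ`, the descended character `κ̄` is continuous and NON-ZERO because `D_w ≰ ker κ`, so the image of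
  `H_F` is `ker κ̄ =` "the prime-to-`p` part up to a `ℤ_p`-line on which `κ̄` is injective").
* §2 **`resH1Hom_decompIn_eq_zero_of_mem_unramifiedKer`** — for a discrete `p`-primary `Γ_K`-module `M` with open stabilisers, a class of
  `H¹(ker κ, M)` unramified at the chosen place above `w` (`GreenbergVatsal2000.unramifiedKer`) DIES on `ker κ ⊓ D_w` (`decompInToH`);
  **`unramifiedKer_le_awayKer`**, **`awayKer_eq_unramifiedKer`** — the same in the `GreenbergSelmer.awayKer` currency of Castella's / Agboola's
  groups: over the line, "unramified at `w`" (Greenberg–Vatsal) and "locally trivial at `w`" (Castella, Agboola: `H¹_f(F_v, W) = 0` for `v ∤ 𝔭`)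
  are THE SAME CONDITION. Greenberg–Vatsal p. 17: "`G_η/I_η` has profinite degree prime to `p`. So the last condition is equivalent to
  `[σ|_{I_η}] = 0`."
* §3 road α: on every frame line `κ₂` (unramified outside `v̄`, `K` imaginary quadratic, `2 = v v̄`) and every finite `w ∤ 2`:
  **`awayKer_eq_unramifiedKer_of_frame`** for `W* = ↥((W.baseChange K).endEigenPrimaryTorsion 2 π r)` (inputs: `hκ₂.inertia_le`, (C1)
  `LineDecomposition.decomp_not_le_kerSubgroup_of_isUnramifiedOutside`, `isOpen_stabilizer_endEigenPrimaryTorsion`,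
  `exists_pow_smul_endEigenPrimaryTorsion_eq_zero`). Consequence for (RES)(b2) (next file): away from `2` the Greenberg group `S_{W*}(K*_∞)` and
  Agboola's `𝔖_v̄(K*_∞, W*)` impose the same conditions, so `S_{W*}(K*_∞) ⧸ 𝔖` is supported ABOVE `v̄` ONLY.

presearch: Greenberg–Vatsal 2000 §2 p. 17; Greenberg LNM 1716 §1; Serre, Galois Cohomology I §2.4 Prop. 9 (`cd_p` of pro-`p′` groups) — held; tree:
bsd-eis `EisensteinPrimesLocallyTrivialAwayIndex` (two-variable twin). beyond-print theorem: no.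

References: [GreenbergVatsal2000] §2 p. 17; [SerreGaloisCohomology1997] I §2.4 Prop. 9, II §5.1; [GreenbergLNM1716] §1; [Washington1997] Prop. 13.2;
[Agboola2007] §3 (arXiv p0008:L58–80).
-/

set_option autoImplicit false
set_option linter.dupNamespace false

noncomputable section

open scoped Classical
open NumberField IsDedekindDomain Field Multiplicative WeierstrassCurve
open Literature.NumberTheory.EllipticCurves Literature.NumberTheory.GaloisRepresentations
  Literature.AnabelianGeometry.AbsoluteAnabelian
open Summit.BirchSwinnertonDyer.BirchSwinnertonDyer.Theorems.GreenbergFullAtSelmer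

namespace Summit.BirchSwinnertonDyer.BirchSwinnertonDyer.Theorems.PrintCf2.LineLocallyTrivial

variable {K : Type} [Field K] [NumberField K] {p : ℕ} [Fact p.Prime] (κ : ZpExtension K p)

/-! ## §1. Hypothesis (★) over a `ℤ_p`-line: `res⁻¹(ker κ) ⧸ I_{K_w}` is pro-prime-to-`p` -/

/-- At a place `w` unramified in the line (`I_w ≤ ker κ`) the local inertia group `I_{K_w}` maps into `ker κ`. [cite: Washington1997, Prop. 13.2] -/
theorem absGaloisRestrict_mem_kerSubgroup_of_mem_absInertia {w : HeightOneSpectrum (𝓞 K)} (hI : GreenbergSelmer.inertia w ≤ κ.kerSubgroup)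
    {i : absoluteGaloisGroup (w.adicCompletion K)} (hi : i ∈ absInertia (w.adicCompletion K)) :
    absGaloisRestrict K (w.adicCompletion K) i ∈ κ.kerSubgroup :=
  hI ⟨i, hi, rfl⟩

/-- `I_F = Gal(F̄/F^nr) ≤ H_F = res⁻¹(ker κ)` at a place unramified in the line. [cite: Washington1997, Prop. 13.2] -/
theorem galUnr_le_comap_kerSubgroup {w : HeightOneSpectrum (𝓞 K)} (hI : GreenbergSelmer.inertia w ≤ κ.kerSubgroup) :
    galUnr (w.adicCompletion K) ≤ κ.kerSubgroup.comap (absGaloisRestrict K (w.adicCompletion K)).toMonoidHom := by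
  intro i hi
  rw [galUnr_eq_absInertia] at hi
  exact absGaloisRestrict_mem_kerSubgroup_of_mem_absInertia κ hI hi

/-- **Hypothesis (★) over a `ℤ_p`-line at a place `w` unramified and NOT totally split in the line.** With `F = K_w` and
`H_F = res⁻¹(ker κ) ≤ Γ_F`: every open subgroup `V` of `H_F` containing `I_F` has index prime to `p` — `Γ_F ⧸ I_F ≅ ∏_ℓ ℤ_ℓ`
(`isFreeProcyclic_quotient_galUnr`), the descended character `κ̄ : ∏_ℓ ℤ_ℓ → ℤ_p` is continuous and non-zero (`D_w ≰ ker κ`), the image of `H_F` is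
`ker κ̄`, and `coprime_index_of_surjective_onto_ker` (fed `κ̄` twice). [cite: SerreGaloisCohomology1997, II §5.1] [cite: GreenbergVatsal2000, §2 p. 17] -/
theorem coprime_index_of_isOpen_preimageKerSubgroup {w : HeightOneSpectrum (𝓞 K)} (hI : GreenbergSelmer.inertia w ≤ κ.kerSubgroup)
    (hD : ¬ GreenbergSelmer.decomp w ≤ κ.kerSubgroup)
    (V : Subgroup ↥(κ.kerSubgroup.comap (absGaloisRestrict K (w.adicCompletion K)).toMonoidHom))
    (hVo : IsOpen (V : Set ↥(κ.kerSubgroup.comap (absGaloisRestrict K (w.adicCompletion K)).toMonoidHom)))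
    (hIV : (galUnr (w.adicCompletion K)).subgroupOf (κ.kerSubgroup.comap (absGaloisRestrict K (w.adicCompletion K)).toMonoidHom) ≤ V) :
    Nat.Coprime p V.index := by
  haveI : CompactSpace (absoluteGaloisGroup (w.adicCompletion K)) := absoluteGaloisGroup_compactSpace (w.adicCompletion K)
  -- the descended character on `C = Γ_F ⧸ galUnr (w.adicCompletion K)`
  have hker : galUnr (w.adicCompletion K) ≤
      (κ.toContinuousMonoidHom.toMonoidHom.comp (absGaloisRestrict K (w.adicCompletion K)).toMonoidHom).ker := by
    intro i hi
    have h := galUnr_le_comap_kerSubgroup κ hI hi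
    change (absGaloisRestrict K (w.adicCompletion K)) (i : absoluteGaloisGroup (w.adicCompletion K)) ∈ κ.kerSubgroup at h
    rw [MonoidHom.mem_ker]
    exact ZpExtension.mem_kerSubgroup.mp h
  let χ : absoluteGaloisGroup (w.adicCompletion K) ⧸ galUnr (w.adicCompletion K) →* Multiplicative ℤ_[p] :=
    QuotientGroup.lift _ _ hker
  have hχ : ∀ s : absoluteGaloisGroup (w.adicCompletion K),
      χ (QuotientGroup.mk s) = κ ((absGaloisRestrict K (w.adicCompletion K)) (s : absoluteGaloisGroup (w.adicCompletion K))) := fun s ↦ rfl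
  have hχc : Continuous χ :=
    (QuotientGroup.isOpenQuotientMap_mk.isQuotientMap.continuous_iff).mpr
      (κ.toContinuousMonoidHom.continuous.comp (absGaloisRestrict K (w.adicCompletion K)).continuous)
  -- `C ≅ ∏_ℓ ℤ_ℓ`
  obtain ⟨e, -⟩ := (isFreeProcyclic_quotient_galUnr (w.adicCompletion K)).exists_continuousMulEquiv_padicProd
  let p₀ : Nat.Primes := ⟨p, Fact.out⟩
  -- the additive character on `∏ ℤ_ℓ`
  let χ' : (∀ q : Nat.Primes, @PadicInt (q : ℕ) ⟨q.2⟩) →+ @PadicInt (p₀ : ℕ) ⟨p₀.2⟩ :=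
    AddMonoidHom.toMultiplicative.symm (χ.comp e.symm.toMonoidHom)
  have hχ' : ∀ x, χ' x = toAdd (χ (e.symm (ofAdd x))) := fun x ↦ rfl
  have hχ'c : Continuous χ' := by
    change Continuous fun x ↦ toAdd (χ (e.symm (ofAdd x)))
    exact continuous_toAdd.comp (hχc.comp (e.symm.continuous.comp continuous_ofAdd))
  -- evaluation of `χ'` on the image of `s ∈ Γ_F`
  have hev : ∀ s : absoluteGaloisGroup (w.adicCompletion K), χ' (toAdd (e (QuotientGroup.mk s))) =
      toAdd (κ ((absGaloisRestrict K (w.adicCompletion K)) (s : absoluteGaloisGroup (w.adicCompletion K)))) := by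
    intro s; rw [hχ', ofAdd_toAdd, ContinuousMulEquiv.symm_apply_apply, hχ]
  -- non-trivial: `w` is not totally split in the line
  have hne : ∃ y, χ' y ≠ 0 ∨ χ' y ≠ 0 := by
    obtain ⟨δ, hδD, hδκ⟩ : ∃ δ ∈ GreenbergSelmer.decomp (K := K) w, δ ∉ κ.kerSubgroup := by
      by_contra h
      push Not at h
      exact hD h
    obtain ⟨σ, hσ⟩ := (GreenbergSelmer.mem_decomp_iff w δ).mp hδD
    refine ⟨toAdd (e (QuotientGroup.mk σ)), Or.inl ?_⟩
    rw [hev, hσ]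
    intro h0
    exact hδκ (ZpExtension.mem_kerSubgroup.mpr (toAdd.injective (by rw [h0, toAdd_one])))
  -- the kernel `K'` and the surjection `g : H_F → K'`
  set K' : AddSubgroup (∀ q : Nat.Primes, @PadicInt (q : ℕ) ⟨q.2⟩) := χ'.ker ⊓ χ'.ker with hK'
  have hgmem : ∀ s : (κ.kerSubgroup.comap (absGaloisRestrict K (w.adicCompletion K)).toMonoidHom),
      toAdd (e (QuotientGroup.mk (s : absoluteGaloisGroup (w.adicCompletion K)))) ∈ K' := by
    intro s
    have hs : (absGaloisRestrict K (w.adicCompletion K)) (s : absoluteGaloisGroup (w.adicCompletion K)) ∈ κ.kerSubgroup := s.2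
    have h1 : toAdd (e (QuotientGroup.mk (s : absoluteGaloisGroup (w.adicCompletion K)))) ∈ χ'.ker := by
      rw [AddMonoidHom.mem_ker, hev, ZpExtension.mem_kerSubgroup.mp hs, toAdd_one]
    exact AddSubgroup.mem_inf.mpr ⟨h1, h1⟩
  let g : (κ.kerSubgroup.comap (absGaloisRestrict K (w.adicCompletion K)).toMonoidHom) →* Multiplicative K' :=
    { toFun := fun s ↦ ofAdd ⟨toAdd (e (QuotientGroup.mk (s : absoluteGaloisGroup (w.adicCompletion K)))), hgmem s⟩
      map_one' := by
        apply toAdd.injective; apply Subtype.ext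
        change toAdd (e (QuotientGroup.mk (1 : absoluteGaloisGroup (w.adicCompletion K)))) = ((0 : K') : ∀ q : Nat.Primes, _)
        rw [QuotientGroup.mk_one, map_one, toAdd_one]
        rfl
      map_mul' := fun s t ↦ by
        apply toAdd.injective; apply Subtype.ext
        change toAdd (e (QuotientGroup.mk ((s : absoluteGaloisGroup (w.adicCompletion K)) * t))) =
          toAdd (e (QuotientGroup.mk (s : absoluteGaloisGroup (w.adicCompletion K)))) +
            toAdd (e (QuotientGroup.mk (t : absoluteGaloisGroup (w.adicCompletion K))))
        rw [QuotientGroup.mk_mul, map_mul, toAdd_mul] }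
  have hgval : ∀ s : (κ.kerSubgroup.comap (absGaloisRestrict K (w.adicCompletion K)).toMonoidHom),
      ((toAdd (g s) : K') : ∀ q : Nat.Primes, @PadicInt (q : ℕ) ⟨q.2⟩) =
        toAdd (e (QuotientGroup.mk (s : absoluteGaloisGroup (w.adicCompletion K)))) := fun s ↦ rfl
  have hgc : Continuous g := by
    refine continuous_ofAdd.comp (Continuous.subtype_mk ?_ _)
    exact continuous_toAdd.comp (e.continuous.comp (QuotientGroup.continuous_mk.comp continuous_subtype_val))
  -- `g` is onto `K'`
  have hgsurj : Function.Surjective g := by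
    intro y
    obtain ⟨s, hs⟩ := QuotientGroup.mk_surjective (e.symm (ofAdd ((toAdd y : K') : ∀ q : Nat.Primes, @PadicInt (q : ℕ) ⟨q.2⟩)))
    have hmemK' : ∀ z, z ∈ K' ↔ χ' z = 0 ∧ χ' z = 0 := fun z ↦ by
      rw [hK', AddSubgroup.mem_inf, AddMonoidHom.mem_ker]
    have hy := (hmemK' _).mp (toAdd y).2
    have hy' : toAdd (κ ((absGaloisRestrict K (w.adicCompletion K)) (s : absoluteGaloisGroup (w.adicCompletion K)))) = 0 := by
      have h := hy.1
      rw [hχ', ← hs, hχ] at h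
      exact h
    have hsH : s ∈ (κ.kerSubgroup.comap (absGaloisRestrict K (w.adicCompletion K)).toMonoidHom) := by
      change (absGaloisRestrict K (w.adicCompletion K)) (s : absoluteGaloisGroup (w.adicCompletion K)) ∈ κ.kerSubgroup
      exact ZpExtension.mem_kerSubgroup.mpr (toAdd.injective (by rw [hy', toAdd_one]))
    refine ⟨⟨s, hsH⟩, ?_⟩
    apply toAdd.injective; apply Subtype.ext
    rw [hgval]
    change toAdd (e (QuotientGroup.mk s)) = _
    rw [hs, ContinuousMulEquiv.apply_symm_apply, toAdd_ofAdd]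
  -- `ker g ≤ V`
  have hgker : g.ker ≤ V := by
    intro s hs
    rw [MonoidHom.mem_ker] at hs
    have h1 : toAdd (e (QuotientGroup.mk (s : absoluteGaloisGroup (w.adicCompletion K)))) = 0 := by
      have := congrArg (fun y : Multiplicative K' ↦ ((toAdd y : K') : ∀ q : Nat.Primes, @PadicInt (q : ℕ) ⟨q.2⟩)) hs
      simp only [hgval, toAdd_one, ZeroMemClass.coe_zero] at this
      exact this
    have h2 : (QuotientGroup.mk (s : absoluteGaloisGroup (w.adicCompletion K)) :
        absoluteGaloisGroup (w.adicCompletion K) ⧸ galUnr (w.adicCompletion K)) = 1 := by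
      apply e.injective
      rw [map_one, ← ofAdd_toAdd (e _), h1, ofAdd_zero]
    exact hIV (Subgroup.mem_subgroupOf.mpr ((QuotientGroup.eq_one_iff _).mp h2))
  -- transport
  have hHFcl : IsClosed ((κ.kerSubgroup.comap (absGaloisRestrict K (w.adicCompletion K)).toMonoidHom :
      Subgroup (absoluteGaloisGroup (w.adicCompletion K))) : Set (absoluteGaloisGroup (w.adicCompletion K))) :=
    κ.isClosed_kerSubgroup.preimage (absGaloisRestrict K (w.adicCompletion K)).continuous
  haveI : CompactSpace (κ.kerSubgroup.comap (absGaloisRestrict K (w.adicCompletion K)).toMonoidHom) :=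
    isCompact_iff_compactSpace.mp hHFcl.isCompact
  exact coprime_index_of_surjective_onto_ker p₀ χ' χ' hχ'c hχ'c hne g hgc hgsurj V hVo hgker

/-! ## §2. Unramified ⟹ locally trivial over the line -/

section Cohomology

variable {M : Type} [AddCommGroup M] [DistribMulAction (absoluteGaloisGroup K) M] [TopologicalSpace M] [DiscreteTopology M]

/-- **UNRAMIFIED ⇒ LOCALLY TRIVIAL over a `ℤ_p`-line at a place unramified and not totally split in the line.** For a discrete `p`-primary
`Γ_K`-module `M` with open stabilisers and a finite place `w` with `I_w ≤ ker κ`, `D_w ≰ ker κ`: a class of `H¹(Gal(K̄/K_∞), M)` which dies on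
`ker κ ⊓ I_w` (`GreenbergVatsal2000.unramifiedKer`) dies on `ker κ ⊓ D_w` (`GreenbergSelmer.decompInToH`) — the pro-`p′` vanishing lemma on
`H_F = res⁻¹(ker κ)` with `I = I_{K_w}`, hypothesis (★) being §1. [cite: GreenbergVatsal2000, §2 p. 17] [cite: SerreGaloisCohomology1997, I §2.4 Prop. 9] -/
theorem resH1Hom_decompIn_eq_zero_of_mem_unramifiedKer
    (hstab : ∀ m : M, IsOpen (MulAction.stabilizer (absoluteGaloisGroup K) m : Set (absoluteGaloisGroup K)))
    (hM : ∀ m : M, ∃ k : ℕ, p ^ k • m = 0)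
    {w : HeightOneSpectrum (𝓞 K)} (hI : GreenbergSelmer.inertia w ≤ κ.kerSubgroup) (hD : ¬ GreenbergSelmer.decomp w ≤ κ.kerSubgroup)
    (y : subgroupH1 κ.kerSubgroup M) (hy : y ∈ GreenbergVatsal2000.unramifiedKer κ.kerSubgroup M w) :
    resH1Hom (GreenbergSelmer.decompInToH κ.kerSubgroup w) (AddMonoidHom.id M) (fun _ _ ↦ rfl) y = 0 := by
  haveI : CompactSpace (absoluteGaloisGroup (w.adicCompletion K)) := absoluteGaloisGroup_compactSpace (w.adicCompletion K)
  have hHFcl : IsClosed ((κ.kerSubgroup.comap (absGaloisRestrict K (w.adicCompletion K)).toMonoidHom) :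
      Set (absoluteGaloisGroup (w.adicCompletion K))) :=
    κ.isClosed_kerSubgroup.preimage (absGaloisRestrict K (w.adicCompletion K)).continuous
  haveI : CompactSpace (κ.kerSubgroup.comap (absGaloisRestrict K (w.adicCompletion K)).toMonoidHom) :=
    isCompact_iff_compactSpace.mp hHFcl.isCompact
  -- `H_F` acts on `M` through `res`
  letI : DistribMulAction (κ.kerSubgroup.comap (absGaloisRestrict K (w.adicCompletion K)).toMonoidHom) M :=
    DistribMulAction.compHom M ((absGaloisRestrict K (w.adicCompletion K)).toMonoidHom.comp
      (κ.kerSubgroup.comap (absGaloisRestrict K (w.adicCompletion K)).toMonoidHom).subtype)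
  have hsmul : ∀ (s : (κ.kerSubgroup.comap (absGaloisRestrict K (w.adicCompletion K)).toMonoidHom)) (m : M),
      s • m = (absGaloisRestrict K (w.adicCompletion K)) (s : absoluteGaloisGroup (w.adicCompletion K)) • m := fun _ _ ↦ rfl
  have hstab' : ∀ m : M, IsOpen (MulAction.stabilizer (κ.kerSubgroup.comap (absGaloisRestrict K (w.adicCompletion K)).toMonoidHom) m :
      Set (κ.kerSubgroup.comap (absGaloisRestrict K (w.adicCompletion K)).toMonoidHom)) := by
    intro m
    have : (MulAction.stabilizer (κ.kerSubgroup.comap (absGaloisRestrict K (w.adicCompletion K)).toMonoidHom) m :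
        Set (κ.kerSubgroup.comap (absGaloisRestrict K (w.adicCompletion K)).toMonoidHom)) =
        (fun s : (κ.kerSubgroup.comap (absGaloisRestrict K (w.adicCompletion K)).toMonoidHom) ↦
          (absGaloisRestrict K (w.adicCompletion K)) (s : absoluteGaloisGroup (w.adicCompletion K))) ⁻¹'
            (MulAction.stabilizer (absoluteGaloisGroup K) m : Set _) := by
      ext s
      simp only [SetLike.mem_coe, MulAction.mem_stabilizer_iff, Set.mem_preimage]
      exact Iff.rfl
    rw [this]
    exact (hstab m).preimage ((absGaloisRestrict K (w.adicCompletion K)).continuous.comp continuous_subtype_val)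
  -- the class as a crossed homomorphism, and its pull-back to `H_F`
  obtain ⟨f, rfl⟩ := oneCocycleClass_surjective _ y
  rw [GreenbergVatsal2000.unramifiedKer, AddMonoidHom.mem_ker, CocycleCriteria.resH1Hom_oneCocycleClass_eq_zero_iff] at hy
  obtain ⟨m₀, hm₀⟩ := hy
  let φ : (κ.kerSubgroup.comap (absGaloisRestrict K (w.adicCompletion K)).toMonoidHom) →ₜ* κ.kerSubgroup :=
    ⟨{ toFun := fun s ↦ ⟨(absGaloisRestrict K (w.adicCompletion K)) (s : absoluteGaloisGroup (w.adicCompletion K)), s.2⟩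
       map_one' := Subtype.ext (map_one (absGaloisRestrict K (w.adicCompletion K)))
       map_mul' := fun s t ↦ Subtype.ext (map_mul (absGaloisRestrict K (w.adicCompletion K)) (s : absoluteGaloisGroup (w.adicCompletion K)) t) },
      ((absGaloisRestrict K (w.adicCompletion K)).continuous.comp continuous_subtype_val).subtype_mk _⟩
  have hφ : ∀ s : (κ.kerSubgroup.comap (absGaloisRestrict K (w.adicCompletion K)).toMonoidHom),
      ((φ s : κ.kerSubgroup) : absoluteGaloisGroup K) = (absGaloisRestrict K (w.adicCompletion K)) (s : absoluteGaloisGroup (w.adicCompletion K)) :=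
    fun _ ↦ rfl
  let z : contOneCocycles (discreteTopRep (κ.kerSubgroup.comap (absGaloisRestrict K (w.adicCompletion K)).toMonoidHom) M) :=
    contOneCocycles.pullback φ (resHomOfEquivariant φ (AddMonoidHom.id M) fun _ _ ↦ rfl) f
  have hz : ∀ s : (κ.kerSubgroup.comap (absGaloisRestrict K (w.adicCompletion K)).toMonoidHom), z.1 s = f.1 (φ s) := fun _ ↦ rfl
  -- the inertia subgroup `I = galUnr (w.adicCompletion K)` inside `H_F`
  let I : Subgroup (κ.kerSubgroup.comap (absGaloisRestrict K (w.adicCompletion K)).toMonoidHom) :=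
    (galUnr (w.adicCompletion K)).subgroupOf (κ.kerSubgroup.comap (absGaloisRestrict K (w.adicCompletion K)).toMonoidHom)
  haveI : I.Normal := (normal_galUnr (w.adicCompletion K)).subgroupOf (κ.kerSubgroup.comap (absGaloisRestrict K (w.adicCompletion K)).toMonoidHom)
  have hzI : ∀ i ∈ I, z.1 i = i • m₀ - m₀ := by
    intro i hi
    have hi' : ((i : (κ.kerSubgroup.comap (absGaloisRestrict K (w.adicCompletion K)).toMonoidHom)) : absoluteGaloisGroup (w.adicCompletion K)) ∈
        absInertia (w.adicCompletion K) := by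
      rw [← galUnr_eq_absInertia]; exact Subgroup.mem_subgroupOf.mp hi
    have hresI : (absGaloisRestrict K (w.adicCompletion K)) (i : absoluteGaloisGroup (w.adicCompletion K)) ∈ GreenbergSelmer.inertia w := ⟨i, hi', rfl⟩
    have hresK : (absGaloisRestrict K (w.adicCompletion K)) (i : absoluteGaloisGroup (w.adicCompletion K)) ∈ κ.kerSubgroup :=
      (i : (κ.kerSubgroup.comap (absGaloisRestrict K (w.adicCompletion K)).toMonoidHom)).2
    let x : GreenbergSelmer.inertiaIn κ.kerSubgroup w :=
      ⟨⟨(absGaloisRestrict K (w.adicCompletion K)) (i : absoluteGaloisGroup (w.adicCompletion K)), GreenbergSelmer.inertia_le_decomp w hresI⟩,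
        (GreenbergSelmer.mem_inertiaIn_iff _ w _).mpr ⟨hresK, hresI⟩⟩
    have key := hm₀ x
    rw [AddMonoidHom.id_apply] at key
    rw [hz, hsmul]
    exact key
  -- the pro-p′ vanishing lemma on `H_F`
  obtain ⟨n, hn⟩ := exists_eq_smul_sub_of_coprime_index hstab' hM I
    (fun V _ hVo hIV ↦ coprime_index_of_isOpen_preimageKerSubgroup κ hI hD V hVo hIV) z hzI
  -- conclude on `ker κ ⊓ D_w`, `D_w = res(Γ_F)`
  rw [CocycleCriteria.resH1Hom_oneCocycleClass_eq_zero_iff]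
  refine ⟨n, fun x ↦ ?_⟩
  obtain ⟨τ, hτ⟩ := (GreenbergSelmer.mem_decomp_iff w _).mp (x : GreenbergSelmer.decomp (K := K) w).2
  have hτH : τ ∈ (κ.kerSubgroup.comap (absGaloisRestrict K (w.adicCompletion K)).toMonoidHom) := by
    change (absGaloisRestrict K (w.adicCompletion K)) (τ : absoluteGaloisGroup (w.adicCompletion K)) ∈ κ.kerSubgroup
    rw [hτ]
    exact (GreenbergSelmer.mem_decompIn_iff _ w _).mp x.2
  have h1 := hn ⟨τ, hτH⟩
  rw [hz, hsmul] at h1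
  have hx : GreenbergSelmer.decompInToH κ.kerSubgroup w x = φ ⟨τ, hτH⟩ := Subtype.ext (by rw [hφ]; exact hτ.symm)
  show (AddMonoidHom.id M) (f.1 (GreenbergSelmer.decompInToH κ.kerSubgroup w x)) =
    ((x : GreenbergSelmer.decomp (K := K) w) : absoluteGaloisGroup K) • n - n
  rw [hx, AddMonoidHom.id_apply, h1, hτ]

/-- From `H¹(ker κ, M) → H¹(decompIn (ker κ) w, M)` (subgroup of `D_w`) to `resOfLe` along `ker κ ⊓ D_w ≤ ker κ` (subgroup of `Γ_K`): the
two restrictions vanish together (same cocycle condition, reindexed). [cite: SerreGaloisCohomology1997, I §2.4 (compatible pairs)] -/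
theorem resOfLe_inf_decomp_eq_zero_of_resH1Hom_decompIn_eq_zero (H : Subgroup (absoluteGaloisGroup K)) (w : HeightOneSpectrum (𝓞 K))
    (y : subgroupH1 H M) (hy : resH1Hom (GreenbergSelmer.decompInToH H w) (AddMonoidHom.id M) (fun _ _ ↦ rfl) y = 0) :
    resOfLe M (inf_le_left : H ⊓ GreenbergSelmer.decomp w ≤ H) y = 0 := by
  obtain ⟨f, rfl⟩ := oneCocycleClass_surjective _ y
  rw [CocycleCriteria.resH1Hom_oneCocycleClass_eq_zero_iff] at hy
  obtain ⟨n, hn⟩ := hy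
  rw [CocycleCriteria.resOfLe_oneCocycleClass_eq_zero_iff]
  refine ⟨n, fun x ↦ ?_⟩
  have hxD : (x : absoluteGaloisGroup K) ∈ GreenbergSelmer.decomp w := (Subgroup.mem_inf.mp x.2).2
  have hxH : (x : absoluteGaloisGroup K) ∈ H := (Subgroup.mem_inf.mp x.2).1
  let x' : GreenbergSelmer.decompIn H w := ⟨⟨(x : absoluteGaloisGroup K), hxD⟩, (GreenbergSelmer.mem_decompIn_iff H w _).mpr hxH⟩
  have h1 := hn x'
  rw [AddMonoidHom.id_apply] at h1
  have hincl : Subgroup.inclusion (inf_le_left : H ⊓ GreenbergSelmer.decomp w ≤ H) x = GreenbergSelmer.decompInToH H w x' := rfl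
  rw [hincl]
  exact h1

/-- **`unramifiedKer ≤ awayKer` over the line** at a place unramified and not totally split: a class of `H¹(K_∞, M)` unramified at the chosen
place above `w` is locally trivial there. [cite: GreenbergVatsal2000, §2 p. 17] -/
theorem unramifiedKer_le_awayKer
    (hstab : ∀ m : M, IsOpen (MulAction.stabilizer (absoluteGaloisGroup K) m : Set (absoluteGaloisGroup K)))
    (hM : ∀ m : M, ∃ k : ℕ, p ^ k • m = 0)
    {w : HeightOneSpectrum (𝓞 K)} (hI : GreenbergSelmer.inertia w ≤ κ.kerSubgroup) (hD : ¬ GreenbergSelmer.decomp w ≤ κ.kerSubgroup) :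
    GreenbergVatsal2000.unramifiedKer κ.kerSubgroup M w ≤ GreenbergSelmer.awayKer κ.kerSubgroup M w := fun y hy ↦ by
  rw [GreenbergSelmer.awayKer, AddMonoidHom.mem_ker]
  exact resOfLe_inf_decomp_eq_zero_of_resH1Hom_decompIn_eq_zero κ.kerSubgroup w y
    (resH1Hom_decompIn_eq_zero_of_mem_unramifiedKer κ hstab hM hI hD y hy)

omit [Fact p.Prime] in
/-- `awayKer ≤ unramifiedKer` (always: locally trivial ⟹ unramified, `resOfLe_mem_unramifiedKer_of_mem_awayKer` along the identity).
[cite: GreenbergVatsal2000, §2 p. 17] -/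
theorem awayKer_le_unramifiedKer (H : Subgroup (absoluteGaloisGroup K)) (w : HeightOneSpectrum (𝓞 K)) :
    GreenbergSelmer.awayKer H M w ≤ GreenbergVatsal2000.unramifiedKer H M w := fun y hy ↦ by
  have h := resOfLe_mem_unramifiedKer_of_mem_awayKer (le_refl H) w hy
  rwa [resOfLe_refl_holds, AddMonoidHom.id_apply] at h

/-- **`awayKer = unramifiedKer` over the line**: at a finite place `w` with `I_w ≤ ker κ` and `D_w ≰ ker κ`, for a discrete `p`-primary `M` with open
stabilisers, Castella's/Agboola's "locally trivial at `w`" and Greenberg–Vatsal's "unramified at `w`" are the same condition on `H¹(K_∞, M)`.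
[cite: GreenbergVatsal2000, §2 p. 17] [cite: Agboola2007, §3 (arXiv p0008:L58–80)] -/
theorem awayKer_eq_unramifiedKer
    (hstab : ∀ m : M, IsOpen (MulAction.stabilizer (absoluteGaloisGroup K) m : Set (absoluteGaloisGroup K)))
    (hM : ∀ m : M, ∃ k : ℕ, p ^ k • m = 0)
    {w : HeightOneSpectrum (𝓞 K)} (hI : GreenbergSelmer.inertia w ≤ κ.kerSubgroup) (hD : ¬ GreenbergSelmer.decomp w ≤ κ.kerSubgroup) :
    GreenbergSelmer.awayKer κ.kerSubgroup M w = GreenbergVatsal2000.unramifiedKer κ.kerSubgroup M w :=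
  le_antisymm (awayKer_le_unramifiedKer κ.kerSubgroup w) (unramifiedKer_le_awayKer κ hstab hM hI hD)

end Cohomology

/-! ## §3. Road α: the line `K*_∞` (unramified outside `v̄`) over an imaginary quadratic `K`, every `w ∤ p` -/

section Frame

open Summit.BirchSwinnertonDyer.BirchSwinnertonDyer.Theorems.PrintCf2.LineDecomposition
open Summit.BirchSwinnertonDyer.BirchSwinnertonDyer.Theorems.PrintCf2.RestrictedSelmerPair
open Literature.NumberTheory.EllipticCurves.Agboola2007

variable {M : Type} [AddCommGroup M] [DistribMulAction (absoluteGaloisGroup K) M] [TopologicalSpace M] [DiscreteTopology M]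

/-- **Over a `ℤ_p`-line unramified outside a split prime `v̄` of an imaginary quadratic field, "unramified" = "locally trivial" at EVERY
`w ∤ p`** (for discrete `p`-primary `M` with open stabilisers): `I_w ≤ ker κ` (`hκ.inertia_le`) and `D_w ≰ ker κ` by (C1)
`LineDecomposition.decomp_not_le_kerSubgroup_of_isUnramifiedOutside` (no finite `w ≠ v̄` splits completely in the line).
[cite: GreenbergVatsal2000, §2 p. 17] [cite: deShalit1987, Ch. II §1.1] -/
theorem awayKer_eq_unramifiedKer_of_isUnramifiedOutside (hK : IsImaginaryQuadratic K) {v vbar : HeightOneSpectrum (𝓞 K)}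
    (hv : ((p : ℕ) : 𝓞 K) ∈ v.asIdeal) (hvbar : ((p : ℕ) : 𝓞 K) ∈ vbar.asIdeal) (hne : vbar ≠ v) (hκ : κ.IsUnramifiedOutside vbar)
    (hstab : ∀ m : M, IsOpen (MulAction.stabilizer (absoluteGaloisGroup K) m : Set (absoluteGaloisGroup K)))
    (hM : ∀ m : M, ∃ k : ℕ, p ^ k • m = 0) {w : HeightOneSpectrum (𝓞 K)} (hw : ((p : ℕ) : 𝓞 K) ∉ w.asIdeal) :
    GreenbergSelmer.awayKer κ.kerSubgroup M w = GreenbergVatsal2000.unramifiedKer κ.kerSubgroup M w := by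
  have hwv : w ≠ vbar := by
    rintro rfl
    exact hw hvbar
  exact awayKer_eq_unramifiedKer κ hstab hM (hκ.inertia_le hwv)
    (decomp_not_le_kerSubgroup_of_isUnramifiedOutside hK hv hvbar hne κ hκ hwv)

/-- **Road α frames, `M = W* = ↥((W.baseChange K).endEigenPrimaryTorsion 2 π r)`, line `κ₂` unramified outside `v̄`**: at every finite `w ∤ 2`,
`awayKer κ₂.kerSubgroup W* w = unramifiedKer κ₂.kerSubgroup W* w` — away from `2`, Agboola's `𝔖_v̄(K*_∞, W*)` and the Greenberg group
`S_{W*}(K*_∞)` impose THE SAME local condition (open stabilisers / `2`-primarity: `isOpen_stabilizer_endEigenPrimaryTorsion`,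
`exists_pow_smul_endEigenPrimaryTorsion_eq_zero`). [cite: GreenbergVatsal2000, §2 p. 17] [cite: Agboola2007, §3 (arXiv p0008:L58–80)] -/
theorem awayKer_eq_unramifiedKer_of_frame (W : WeierstrassCurve ℚ) (hK : IsImaginaryQuadratic K) {v vbar : HeightOneSpectrum (𝓞 K)}
    (hv : ((2 : ℕ) : 𝓞 K) ∈ v.asIdeal) (hvbar : ((2 : ℕ) : 𝓞 K) ∈ vbar.asIdeal) (hne : vbar ≠ v) (π : (W.baseChange K).endRing) (r : ℤ_[2])
    (κ₂ : ZpExtension K 2) (hκ₂ : κ₂.IsUnramifiedOutside vbar) {w : HeightOneSpectrum (𝓞 K)} (hw : ((2 : ℕ) : 𝓞 K) ∉ w.asIdeal) :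
    GreenbergSelmer.awayKer κ₂.kerSubgroup ↥((W.baseChange K).endEigenPrimaryTorsion 2 π r) w =
      GreenbergVatsal2000.unramifiedKer κ₂.kerSubgroup ↥((W.baseChange K).endEigenPrimaryTorsion 2 π r) w :=
  awayKer_eq_unramifiedKer_of_isUnramifiedOutside κ₂ hK hv hvbar hne hκ₂ (isOpen_stabilizer_endEigenPrimaryTorsion _ 2 π r)
    (exists_pow_smul_endEigenPrimaryTorsion_eq_zero _ 2 π r) hw

end Frame

end Summit.BirchSwinnertonDyer.BirchSwinnertonDyer.Theorems.PrintCf2.LineLocallyTrivial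

end
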